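import Summits.BirchSwinnertonDyer.BirchSwinnertonDyer.Theorems.GenusKolyvaginAtTwoMultiGenusPrimitivityAtTwoAuxiliaryFieldLevelOne
import Summits.BirchSwinnertonDyer.BirchSwinnertonDyer.Theorems.GenusKolyvaginAtTwoGenusPrimitiveSupplyAtTwoTwistingPrimeGenusPair
import Literature.NumberTheory.EllipticCurves.HeegnerPointsIdentityComponentProofs

/-!
# Route `GenusKolyvaginAtTwo`, crux stmt-BirchSwinnertonDyer-24947 `MultiGenusPrimitivityAtTwo` (U): on WALL row 1 the certificate
# follows from Mazur–Rubin Cor. 3.4 (i) (print) and AUXILIARY-FIELD PRIMITIVITY alone — the SUPPLY is kernel-closed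

Lead prover seat bsd-line-gk2-p1 (g6); composition of this lineage's depth-one auxiliary-field certificate
(`…AuxiliaryFieldLevelOne`, p616107) with gk2-p4 g7's twisting-prime capstone
(`GenusKolyTwistingPrime.exists_kolyvaginPrime_genusPair_selmer_of_cor34i`, p615571). On the route's live reach — `Δ(W) < 0`,
`ρ̄_{W,2}` onto, `#Sel₂(W) = 4` (WALL row 1: `Ш(E)[2] ≅ (ℤ/2)²`, the census's `t = 1`), a Heegner field `K` with odd `d_K ≠ −3`, a
globally minimal twin `Wd ≅ W^{(d_K)}` with `#Sel₂(Wd) = 2`, and McCallum's `M₀ ≥ 1` (`2 ∣ P(1)`; `M₀ = 0` is `stub_levelOne`,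
PROVED) — the crux's certificate clause `∃ (n, d, θ, T), … Σ_{g∈T} g·y(n) ∉ 2E(K[n])` FOLLOWS from:
* the PRINT fact `MazurRubin2010.cor34i_singleton_rat` (Mazur–Rubin 2010 Cor. 3.4 (i)), through gk2-p4's capstone: a Kolyvagin prime
  `ℓ ≡ 7 (mod 8)` exists (beyond any finite set) whose genus pair is 2-Selmer-minimal — every elliptic model of `Wd^{(−ℓ)}` has
  `#Sel₂ = 1`; the datum, radicals, enumeration and reduced genus point at level `ℓ` exist unconditionally (Gross §3 CM facts PROVED
  in the tree, `…DepthLaw`, `…ReducedGenusPoint`);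
* AUX-PRIMITIVITY (displayed hypothesis `haux`, the OPEN KERNEL, = W. Zhang's base case of Kolyvagin's conjecture at `p = 2` read in
  `E(ℚ(√−ℓ)) ⊗ ℤ₂`): at every Kolyvagin prime `ℓ ≡ 7 (8)` whose even genus twist is Sel₂-trivial, no odd multiple of the reduced
  genus point `W_ℓ` is twice a `ℚ(θ_ℓ)`-rational point of `E(K[ℓ])`.
So on row 1 the LEVEL LAW's «SUPPLY ∧ EXACT-INDEX₂» (crux memo `Lines/genus-supply-depthlaw.md` §3, `genus-supply-local.md` §2/§4) is
now «cor34i ∧ AUX-PRIMITIVITY» with everything else kernel-checked. Helper (`--supports stmt-BirchSwinnertonDyer-24947`); the only named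
fact in the cone is `cor34i_singleton_rat` (displayed); BSD is not proved by any of this.

References: [GrossLMS1991] §3–§5; [McCallumLMS1991] §5; [MazurRubin2010] Prop. 3.3, Cor. 3.4 (i); [Cox2013] §9.A Lemma 9.3;
[SilvermanAEC2009] X.2 Prop. 2.4, X.4.2, X.5 Cor. 5.4, VIII.6.7; [WZhang2014] Thm. 1.1 (the `p ≥ 5` prototype).
-/

set_option linter.dupNamespace false -- tree convention: `Summit.BirchSwinnertonDyer.BirchSwinnertonDyer.Theorems` (summit = sub-problem)

noncomputable section

open scoped Classical

namespace Summit.BirchSwinnertonDyer.BirchSwinnertonDyer.Theorems.GenusKoly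

open Finset NumberField WeierstrassCurve Literature.NumberTheory.EllipticCurves
  Literature.NumberTheory.EllipticCurves.ModularForms
  Summit.BirchSwinnertonDyer.BirchSwinnertonDyer.Theorems.GenusKolyTwistingPrime

section Heegner

variable {W : WeierstrassCurve ℚ} [NeZero (W.conductorNorm ℤ)] {K : Type} [Field K] [NumberField K]
  {Dt : ModularParametrizationData W (W.conductorNorm ℤ)} {β : ℤ} {ι : K →+* ℂ}

omit [NeZero (W.conductorNorm ℤ)] [NumberField K] in
/-- The even genus twist as a model of `W^{(ℓ*·d_K)}`: for `4 ∣ ℓ + 1` (so `ℓ* = −ℓ`) and `Wd = C • W^{(d_K)}`,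
`Wd^{(−ℓ)} = C' • W^{(ℓ*·d_K)}` with `C' = (u, −ℓ r, 0, 0)` (twisting commutes with variable changes and is multiplicative on the
nose in the tree's model). [cite: SilvermanAEC2009, X.2 Prop. 2.4, X.5 Cor. 5.4] -/
theorem exists_smul_quadraticTwist_pStar_mul_eq_twin_quadraticTwist {ℓ : ℕ} (h4 : 4 ∣ ℓ + 1) {dK : ℚ}
    {Wd : WeierstrassCurve ℚ} {C : VariableChange ℚ} (hWd : C • W.quadraticTwist dK = Wd) :
    ∃ C' : VariableChange ℚ, C' • W.quadraticTwist (((-1 : ℚ) ^ (ℓ / 2) * ℓ) * dK) = Wd.quadraticTwist (-(ℓ : ℚ)) :=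
  ⟨⟨C.u, (-(ℓ : ℚ)) * C.r, 0, 0⟩, by
    rw [pStar_eq_neg_of_four_dvd_succ h4, mul_comm (-(ℓ : ℚ)) dK, ← hWd, quadraticTwist_smul,
      quadraticTwist_quadraticTwist]⟩

/-- **WALL ROW 1: the crux's certificate from Cor. 3.4 (i) and AUXILIARY-FIELD PRIMITIVITY.** `W` globally minimal with `Δ < 0`,
`ρ̄_{W,2}` onto, `#Sel₂(W) = 4`; `K` imaginary quadratic, odd `d_K ≠ −3`, Heegner; `Wd = C • W^{(d_K)}` globally minimal with
`#Sel₂(Wd) = 2`; a conductor-1 datum `d₁` with `2 ∣ P(1)` (`M₀ ≥ 1`). IF (`haux`) at every Kolyvagin prime `ℓ ≡ 7 (8)` at `2` whose even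
genus twist `Wd^{(−ℓ)}` has all elliptic models Sel₂-trivial, for all data/radicals/enumerations/reduced genus points `W_ℓ` at level
`ℓ`, no odd multiple of `W_ℓ` is twice a `ℚ(θ_ℓ)`-rational point — THEN the certificate clause of `MultiGenusPrimitivityAtTwo` /
`stub_positiveDepth` holds. CONDITIONAL on the print fact `cor34i_singleton_rat` (`h34`) and on `haux` (the open kernel); the
Kolyvagin prime, the datum, the radicals, `G` and `W_ℓ` are PRODUCED (gk2-p4's capstone; Gross §3 CM facts proved; depth law).
[cite: MazurRubin2010, Cor. 3.4 (i), Prop. 3.3] [cite: GrossLMS1991, §3 (3.1)–(3.5), §4 (4.1), Lemma 4.3, §5]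
[cite: McCallumLMS1991, §5] [cite: WZhang2014, Thm. 1.1 (the p ≥ 5 prototype)] -/
theorem heegner_exists_multiGenusCertificate_rowOne_of_cor34i_of_auxPrimitive [W.IsElliptic] [W.IsGloballyMinimal]
    (h34 : MazurRubin2010.cor34i_singleton_rat)
    (hK : IsImaginaryQuadratic K) (hodd : Odd (NumberField.discr K)) (h3 : NumberField.discr K ≠ -3)
    (hH : SatisfiesHeegnerHypothesis (W.conductorNorm ℤ) K) (hsurj : W.HasSurjectiveModNGaloisRep ((2 : ℤ) ^ 1))
    (hΔ : W.Δ < 0) (h4 : Nat.card (W.selmerGroup 2) = 4)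
    {Wd : WeierstrassCurve ℚ} [Wd.IsElliptic] [Wd.IsGloballyMinimal] {C : VariableChange ℚ}
    (hWd : C • W.quadraticTwist (NumberField.discr K : ℚ) = Wd) (h2 : Nat.card (Wd.selmerGroup 2) = 2)
    (d₁ : KolyvaginHeegnerData Dt β ι 1)
    (hM : ∃ Q₁ : (W.baseChange (ringClassField K ι 1)).toAffine.Point, (2 : ℤ) • Q₁ = d₁.derivedPoint)
    (haux : ∀ ℓ : ℕ, ℓ.Prime → ℓ % 8 = 7 → Zhang2014.IsKolyvaginPrime (W.conductorNorm ℤ) W K 2 ℓ →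
      (∀ (W₂ : WeierstrassCurve ℚ) [W₂.IsElliptic],
        (∃ C₂ : VariableChange ℚ, C₂ • Wd.quadraticTwist (-(ℓ : ℚ)) = W₂) → Nat.card (W₂.selmerGroup 2) = 1) →
      ∀ (d : KolyvaginHeegnerData Dt β ι ℓ) (θ : ℕ → ringClassField K ι ℓ),
        (∀ ℓ' ∈ ℓ.primeFactors, θ ℓ' ^ 2 = algebraMap ℚ (ringClassField K ι ℓ) ((-1 : ℚ) ^ (ℓ' / 2) * ℓ')) →
      ∀ (G : Finset (ringClassField K ι ℓ ≃ₐ[ℚ] ringClassField K ι ℓ)), (∀ g, g ∈ G ↔ g ∈ ringClassGal ι ℓ) →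
      ∀ (Wn : (W.baseChange (ringClassField K ι ℓ)).toAffine.Point),
        ((2 : ℤ) ^ ℓ.primeFactors.card) • Wn =
          ∑ g ∈ G, (∏ ℓ' ∈ ℓ.primeFactors, (if g (θ ℓ') = θ ℓ' then (1 : ℤ) else -1)) •
            pointGalHom W (ringClassField K ι ℓ) g d.y →
      ∀ m : ℕ, Odd m → ¬ ∃ Q : (W.baseChange (ringClassField K ι ℓ)).toAffine.Point,
        (∀ g : ringClassField K ι ℓ ≃ₐ[ℚ] ringClassField K ι ℓ, g (θ ℓ) = θ ℓ →
          pointGalHom W (ringClassField K ι ℓ) g Q = Q) ∧ (2 : ℤ) • Q = (m : ℤ) • Wn) :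
    ∃ (n : ℕ) (d : KolyvaginHeegnerData Dt β ι n) (θ : ℕ → ringClassField K ι n)
      (T : Finset (ringClassField K ι n ≃ₐ[ℚ] ringClassField K ι n)),
      Squarefree n ∧ (∀ ℓ ∈ n.primeFactors, Zhang2014.IsKolyvaginPrime (W.conductorNorm ℤ) W K 2 ℓ) ∧
      (∀ ℓ ∈ n.primeFactors, θ ℓ ^ 2 = algebraMap ℚ (ringClassField K ι n) ((-1 : ℚ) ^ (ℓ / 2) * ℓ)) ∧
      (∀ g, g ∈ T ↔ g ∈ ringClassGal ι n ∧ ∀ ℓ ∈ n.primeFactors, g (θ ℓ) = θ ℓ) ∧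
      ¬ ∃ Q : (W.baseChange (ringClassField K ι n)).toAffine.Point, (2 : ℤ) • Q =
        ∑ g ∈ T, pointGalHom W (ringClassField K ι n) g d.y := by
  have hsurj2 : W.HasSurjectiveModNGaloisRep 2 := by simpa using hsurj
  -- the Kolyvagin prime with Sel₂-minimal genus pair (gk2-p4's capstone, mod Cor. 3.4 (i))
  obtain ⟨ℓ, hℓF, -, hℓ8, hKolyG, -, hSel1⟩ :=
    exists_kolyvaginPrime_genusPair_selmer_of_cor34i W h34 hsurj2 hΔ h4 hK hWd h2 ∅
  have hℓ : ℓ.Prime := hℓF.out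
  have hKolyZ : Zhang2014.IsKolyvaginPrime (W.conductorNorm ℤ) W K 2 ℓ :=
    Zhang2014.isKolyvaginPrime_of_isKolyvaginPrime W Dt.isNewformOf Nat.prime_two hKolyG
  have hKoly : ∀ ℓ' ∈ ℓ.primeFactors, Zhang2014.IsKolyvaginPrime (W.conductorNorm ℤ) W K 2 ℓ' := by
    intro ℓ' hℓ'
    rw [Nat.Prime.primeFactors hℓ, Finset.mem_singleton] at hℓ'
    rw [hℓ']
    exact hKolyZ
  have hsq : Squarefree ℓ := Irreducible.squarefree hℓ
  -- datum, radicals, enumeration, reduced genus point at level `ℓ` (all unconditional)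
  have hinert : ∀ q ∈ ℓ.primeFactors, (Ideal.span {(q : 𝓞 K)}).IsPrime := fun q hq ↦ (hKoly q hq).2.2.2.2.1
  obtain ⟨d⟩ : Nonempty (KolyvaginHeegnerData Dt β ι ℓ) :=
    nonempty_kolyvaginHeegnerData_of_grossCM
      (phi_heegnerPointOfConductor_mem_range_map_ringClassField_holds (W.conductorNorm ℤ) W K)
      exists_generator_ringClassGalOver_holds hK hH Dt β ι d₁.dvd_sq_sub hsq hinert
  obtain ⟨θ, hθ⟩ := heegner_exists_multiGenusRadicals hK hsq hKoly d
  obtain ⟨G, hG⟩ := heegner_exists_finset_ringClassGal (ι := ι) hK hℓ.ne_zero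
  obtain ⟨⟨Wn, hWn, -⟩, -⟩ := heegner_existsUnique_reducedGenusPoint hK hodd h3 hH hsurj hsq hKoly d hθ G hG
  obtain ⟨s₀, hs₀, hs₀2⟩ := heegner_exists_sqrt_discr hK
  -- the even genus twist `Wd^{(−ℓ)}` is an elliptic model of `W^{(ℓ*·d_K)}` with `#Sel₂ = 1`
  have hℓ0 : (-(ℓ : ℚ)) ≠ 0 := neg_ne_zero.mpr (by exact_mod_cast hℓ.ne_zero)
  haveI : (Wd.quadraticTwist (-(ℓ : ℚ))).IsElliptic := isElliptic_quadraticTwist Wd hℓ0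
  have hSelWe : Nat.card ((Wd.quadraticTwist (-(ℓ : ℚ))).selmerGroup 2) = 1 := hSel1 _ ⟨1, one_smul _ _⟩
  have h4ℓ : 4 ∣ ℓ + 1 := by omega
  obtain ⟨C', hC'⟩ := exists_smul_quadraticTwist_pStar_mul_eq_twin_quadraticTwist (W := W) h4ℓ hWd
  exact heegner_exists_multiGenusCertificate_of_auxFieldPrimitive_levelOne hK hodd h3 hH hsurj d₁ hM
    ⟨ℓ, d, θ, G, Wn, s₀, (NumberField.discr K : ℚ), Wd.quadraticTwist (-(ℓ : ℚ)), inferInstance, hℓ, hKoly, hθ, hG, hs₀, hs₀2,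
      ⟨C', hC'⟩, hSelWe, hWn, haux ℓ hℓ hℓ8 hKolyZ hSel1 d θ hθ G hG Wn hWn⟩

end Heegner

end Summit.BirchSwinnertonDyer.BirchSwinnertonDyer.Theorems.GenusKoly

end
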